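import Summits.QuantumFields.YangMills.Theorems.BalabanUVNodesN15CurvedGluingSpeciesCommutatorAdjointDefect
import Summits.QuantumFields.YangMills.Theorems.BalabanUVNodesN15CurvedGluingCubeDressedGeneral
import Summits.QuantumFields.YangMills.Theorems.BalabanUVNodesN15TwoSpacingGluingInputLocalized
import Summits.QuantumFields.YangMills.Theorems.BalabanUVNodesN15TwoSpacingGluingNonlocal
import HarnessLib

/-!
# Route «BalabanUVNodes» (cluster K4 «SpineRates»), Track-A DAG node N15 = NE2, BACKGROUND LAYER — THE ADJOINT ARRANGEMENT `X∘[𝒱, M_h]` OF THE DRESSED PERTURBATION's COMMUTATOR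
# WITH THE PARTITION, its letter and its η-defect, OUTPUT-localized — the `𝒱`-half of FILE 55∕58's adjoint remainder rows `hKcL` ∕ `hDKL` (`G_□∘[Δ_a, M_{h_□}]`) when the cube is dressed
# at a live background (the twin of files 26∕28, which did the left arrangement `[𝒱, M_h]∘X`)

Cell `pub-ymgap`, seat `pub-ymgap-dag-n15-w5` (WIDTH SEAT w5 on node N15, director-ym R399 (3a) ∕ HUMAN RULING D-0149; dag-n15-w3 g3's located successor piece (g) «ADJOINT-ARRANGEMENT
rows», HOME `pub-ymgap-dag-n15-w3/HANDOFF.md` §«What remains after g3»).  `bears_on: R4∕N15 · K3⁷ SpineGivenEndpointR13SepCoPH (stmt-QuantumFields-20544)`.  Filed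
`--kind proof --supports stmt-QuantumFields-20544 --as helper` — COUNT-NEUTRAL.  Theorems only; 0 `def`, 0 `sorry`.  Imports BY NAME dag-n15-w3 file 15
`…N15CurvedGluingSpeciesCommutatorAdjointDefect` (`hasMaj_idef_comp_commOp_speciesOpM`; through it file 14 `hasMaj_comp_commOp_speciesOpM`), file 23 `…N15CurvedGluingCubeDressedGeneral`
(the bridge `speciesOpM_eq_unstackM_comp_jet`), dag-n15-c FILE 57 `…N15TwoSpacingGluingInputLocalized` (`hasMaj_comp_commOp_of_add`, `hasMaj_comp_exp_out`) and FILE 56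
`…N15TwoSpacingGluingNonlocal` (`hasMaj_commOp_nonlocal`, `hasMaj_idef_commOp_nonlocal`); lit `T4EtaRateDefect` (`idef_comp`, `idef_add`); nothing in the tree is modified.

WHY.  FILE 55's bundle wants, for every cube, BOTH arrangements of the remainder's commutator row — `[Δ_a, M_{h_□}]∘G_□` (`hKc`, η-defect `hDK`) and `G_□∘[Δ_a, M_{h_□}]` (`hKcL`, η-defect
`hDKL`); for a nonlocal `Δ_a` FILE 58 takes them ONE-SIDED (input- resp. output-localized).  At a live background `Δ_a = Δ_flat − 𝒱` with the dressed perturbation `𝒱 = V̂∘jet`; files 26∕28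
delivered the `𝒱`-half of the LEFT rows through the pair's entries `X̂ = jet∘X`.  In the ADJOINT arrangement `X∘[𝒱, M_h]` the jet trails (`X∘(V̂M_a − M_hV̂)∘jet + X∘V̂∘D_h`) and carries
`η⁻¹`, so no letter of a generic `V̂` closes the row: it is STRUCTURAL in the presentation the knit uses, `V̂ = unstackM C A + N∘pr₀` — the local first-order species `V(C, A)` read on the jet
(file 23's bridge `unstackM C A ∘ jet = V(C, A)`) plus a base operator `N` carrying a decaying letter (the block-local averaging words (3.60), the nonlocal Landau `P₁(A)` (3.76), file 27) —
i.e. `𝒱 = V(C, A) + N` (§3 `unstackM_add_base_comp_jet`, exact).  The species half is dag-n15-w3 file 14∕15's adjoint row BY NAME (the cube's two-sided entry 0 and RIGHT entries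
`G∘∇^±_μ`, only diagonal factors after them — [B6] (2.91)–(2.92) transposed); the nonlocal half is [B5]'s `P(dh)` letter `[N, M_h] ≤ (ℓ(eε)⁻¹ + 2ω)c_N·e^{−(δ_N−ε)d}` (FILE 56) read
through the cube's OUTPUT indicator (FILE 57 `hasMaj_comp_exp_out`; [B5] p. 39 «adjoint representation»).  NEW here and generic: §1 ★★ `hasMaj_idef_comp_commOp_of_add`, the η-DEFECT twin of
FILE 57's adjoint row `hasMaj_comp_commOp_of_add` for any `Δ_loc + N` (Leibniz `𝔇(G′∘K′, G∘K) = G′∘𝔇(K′, K) + 𝔇(G′, G)∘K` + two output-localized compositions), which FILE 58's `hDKL`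
had no supplier for.

* §1 `loc₂_le_out`, ★★ `hasMaj_idef_comp_commOp_of_add` (generic carriers: `𝔇(G′∘[Δ′_loc + N′, M_{h′}], G∘[Δ_loc + N, M_h]) ≤ 1_S(y)·(r₁ + β′r_Kc_r + m₀c_Kc_r)·e^{−ρd}`);
* §2 on the vector carrier `X × ι`: ★★ `hasMaj_comp_commOp_speciesOpM_add` (`G∘[V(C,A) + N, M_h] ≤ 1_S(y)·(|J|·2r_A(c₁β + c₀β₁) + β·(ℓ(eε)⁻¹ + 2ω)R_N·c_r)·e^{−ρd}`),
  ★★ `hasMaj_idef_comp_commOp_speciesOpM_add` (its η-defect: file 15's `r_W` + FILE 56's defect letter of `[N, M_h]` + the right-entry defect through `[N, M_h]`);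
* §3 `unstackM_add_base_comp_jet` (`(unstackM C A + N∘pr₀)∘jet = V(C, A) + N`, exact), ★ `hasMaj_comp_commOp_dressedPert`, ★ `hasMaj_idef_comp_commOp_dressedPert` (§2 restated for the
  dressed perturbation `𝒱 = V̂∘jet` of file 23, `V̂ = unstackM C A + N∘pr₀` — the shapes a knit at a live background feeds FILE 58 `gluedLetters_of_cubeRows_in` as `hKcL` ∕ `hDKL` with
  `G := X_□ = pr₀∘bgPropV (stack G₀ D) V̂`, whose two-sided entry 0 ∕ right entries ∕ defects are files 23–25 by name).

HONEST FRAMING ∕ LIMITS.  Finite-dimensional operator algebra + block-majorant bookkeeping over DISPLAYED letters (the cube's entries `β, β₁` and defects `m₀, m₁`, the species rows `r_A`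
and fits `o_At`, the partition's `c₀, c₁, o₀, o₁, ℓ, ω, o`, the nonlocal letter `c_N, δ_N` and its defect `r_N`); [B5] (1.120)–(1.128) pp. 37–39, [B6] (2.91)–(2.92) p. 239 ∕
(2.133)–(2.134) p. 247, [B9] (3.52) p. 400 ∕ (3.62)–(3.65) pp. 402–403 ∕ (3.76)–(3.77) pp. 405–406 ∕ Thm 3.14 pp. 426–427 = SHAPES ∕ MECHANISM — nothing of [B5]∕[B6]∕[B9] asserted.
NE2⁺ NOT PRINTED, NOT proved; N15 NOT discharged; counts of record UNMOVED (typed 28∕28 · discharged 5∕27); one finite 𝕋⁴ at fixed ε — NOT infinite volume, NOT OS on ℝ⁴, NOT a mass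
gap, NOT Clay; R4 closes the conditional finite-𝕋⁴ rung `BalabanLadder.UV` only.  Restate-immune (no Theses import).
-/

set_option autoImplicit false

noncomputable section
open scoped BigOperators
open Finset

namespace Summit.QuantumFields.YangMills.BalabanUVNodes.N15.CurvedSpecies

open Literature.MathematicalPhysics.QuantumFieldTheory.Balaban1983to89
open Literature.MathematicalPhysics.QuantumFieldTheory.Balaban1983to89.B11SectG (BlockNorm HasMaj RowSum)
open Literature.MathematicalPhysics.QuantumFieldTheory.Balaban1983to89.B6RandomWalk (Triangle254)
open Literature.MathematicalPhysics.QuantumFieldTheory.Balaban1983to89.T4EtaRateDefect (idef idef_comp idef_add)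
open Literature.MathematicalPhysics.QuantumFieldTheory.Balaban1983to89.T4EtaRateCoeffDefect (pull)
open Literature.MathematicalPhysics.QuantumFieldTheory.Balaban1983to89.B6Prop26Gluing (mulOp ind ind_nonneg ind_le_one)
open Summit.QuantumFields.YangMills.BalabanUVNodes.N15.MatrixSpecies (mmulOp liftMap liftBlk liftEquiv)
open Summit.QuantumFields.YangMills.BalabanUVNodes.N15.BackgroundLayer (fgrad bgrad speciesOpM stack projO unstackM projO_none_comp_stack)
open Summit.QuantumFields.YangMills.BalabanUVNodes.N15.Gluing (commOp commOp_add_left hasMaj_comp_exp_out hasMaj_comp_commOp_of_add hasMaj_commOp_nonlocal hasMaj_idef_commOp_nonlocal)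

/-! ## §1 The η-defect of the adjoint row of `Δ_loc + N`, output-localized (generic carriers) -/

section Generic

variable {X X' : Type} [Fintype X] [Fintype X'] {g : B6.Geometry} (blk : X → g.Site) (π : X' → X) {σ cr : ℝ}

omit [Fintype X] [Fintype X'] in
/-- A two-sided localized row at rate `δ` is an output-localized row at any rate `ρ ≤ δ` (drop `1_S(y′) ≤ 1`, slow the exponential). [folklore] -/
theorem loc₂_le_out {S : Set g.Site} {c δ ρ : ℝ} (hc : 0 ≤ c) (hd : ∀ a b : g.Site, 0 ≤ g.dist a b) (hρδ : ρ ≤ δ) (y y' : g.Site) :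
    ind S y * ind S y' * (c * Real.exp (-(δ * g.dist y y'))) ≤ ind S y * (c * Real.exp (-(ρ * g.dist y y'))) := by
  have hexp : Real.exp (-(δ * g.dist y y')) ≤ Real.exp (-(ρ * g.dist y y')) := Real.exp_le_exp.2 (by nlinarith [hd y y'])
  have h0 : 0 ≤ ind S y * (c * Real.exp (-(ρ * g.dist y y'))) := mul_nonneg (ind_nonneg _ _) (mul_nonneg hc (Real.exp_nonneg _))
  calc ind S y * ind S y' * (c * Real.exp (-(δ * g.dist y y'))) ≤ ind S y * ind S y' * (c * Real.exp (-(ρ * g.dist y y'))) :=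
        mul_le_mul_of_nonneg_left (mul_le_mul_of_nonneg_left hexp hc) (mul_nonneg (ind_nonneg _ _) (ind_nonneg _ _))
    _ = ind S y' * (ind S y * (c * Real.exp (-(ρ * g.dist y y')))) := by ring
    _ ≤ 1 * (ind S y * (c * Real.exp (-(ρ * g.dist y y')))) := mul_le_mul_of_nonneg_right (ind_le_one S y') h0
    _ = _ := one_mul _

/-- ★★ **THE η-DEFECT OF THE ADJOINT ROW OF `Δ_loc + N`** (the two-grid twin of FILE 57 `hasMaj_comp_commOp_of_add`, output-localized as FILE 58's `hDKL` wants).  Leibniz: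
`𝔇(G′∘[Δ′_loc + N′, M_{h′}], G∘[Δ_loc + N, M_h]) = 𝔇(G′∘[Δ′_loc, M_{h′}], G∘[Δ_loc, M_h]) + G′∘𝔇([N′, M_{h′}], [N, M_h]) + 𝔇(G′, G)∘[N, M_h]`.  Data: the two-sided local defect row
`≤ 1_S1_S·r₁e^{−δd}`, the fine cube `G′ ≤ 1_S1_S·β′e^{−δd}`, the cube's defect `𝔇(G′, G) ≤ 1_S1_S·m₀e^{−δd}`, the nonlocal commutator `[N, M_h] ≤ c_K·e^{−ρ₁d}` and its defect
`𝔇([N′, M_{h′}], [N, M_h]) ≤ r_K·e^{−ρ₁d}` (FILE 56), rates `0 ≤ ρ ≤ ρ₁`, `ρ + σ ≤ δ`, `σ ≥ 0`, row sum `(σ, c_r)` ⟹ `≤ 1_S(y)·(r₁ + β′r_Kc_r + m₀c_Kc_r)·e^{−ρd}`.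
[cite: Balaban1984PropagatorsI, (1.121) p.37, (1.128) p.38, p.39 (adjoint representation: mechanism); Balaban1984PropagatorsII, (2.134) p.247 (shape); Balaban1985BackgroundPropagators, Thm 3.14 pp.426–427 (difference template)] -/
theorem hasMaj_idef_comp_commOp_of_add (htri : Triangle254 g) (hd : ∀ a b : g.Site, 0 ≤ g.dist a b) (hrow : RowSum g σ cr) (hσ : 0 ≤ σ)
    {Δloc N G : (X → ℝ) →ₗ[ℝ] (X → ℝ)} {Δloc' N' G' : (X' → ℝ) →ₗ[ℝ] (X' → ℝ)} {h : X → ℝ} {h' : X' → ℝ} {S : Set g.Site} {r₁ β' m₀ cK rK δ ρ ρ₁ : ℝ}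
    (hr₁ : 0 ≤ r₁) (hβ' : 0 ≤ β') (hm₀ : 0 ≤ m₀) (hcK : 0 ≤ cK) (hrK : 0 ≤ rK) (hρ : 0 ≤ ρ) (hρ₁ : ρ ≤ ρ₁) (hρδ : ρ + σ ≤ δ)
    (hDloc : HasMaj (BlockNorm.ofBlocks g blk) (BlockNorm.ofBlocks g (blk ∘ π)) (idef (pull π) (pull π) (G' ∘ₗ commOp Δloc' h') (G ∘ₗ commOp Δloc h))
      (fun y y' => ind S y * ind S y' * (r₁ * Real.exp (-(δ * g.dist y y')))))
    (hG' : HasMaj (BlockNorm.ofBlocks g (blk ∘ π)) (BlockNorm.ofBlocks g (blk ∘ π)) G' (fun y y' => ind S y * ind S y' * (β' * Real.exp (-(δ * g.dist y y')))))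
    (hDG : HasMaj (BlockNorm.ofBlocks g blk) (BlockNorm.ofBlocks g (blk ∘ π)) (idef (pull π) (pull π) G' G) (fun y y' => ind S y * ind S y' * (m₀ * Real.exp (-(δ * g.dist y y')))))
    (hKN : HasMaj (BlockNorm.ofBlocks g blk) (BlockNorm.ofBlocks g blk) (commOp N h) (fun y y' => cK * Real.exp (-(ρ₁ * g.dist y y'))))
    (hDKN : HasMaj (BlockNorm.ofBlocks g blk) (BlockNorm.ofBlocks g (blk ∘ π)) (idef (pull π) (pull π) (commOp N' h') (commOp N h))
      (fun y y' => rK * Real.exp (-(ρ₁ * g.dist y y')))) :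
    HasMaj (BlockNorm.ofBlocks g blk) (BlockNorm.ofBlocks g (blk ∘ π)) (idef (pull π) (pull π) (G' ∘ₗ commOp (Δloc' + N') h') (G ∘ₗ commOp (Δloc + N) h))
      (fun y y' => ind S y * ((r₁ + β' * rK * cr + m₀ * cK * cr) * Real.exp (-(ρ * g.dist y y')))) := by
  -- the nonlocal defect through the fine cube's output, and the cube's defect through the coarse nonlocal commutator
  have t1 := hasMaj_comp_exp_out (blk ∘ π) htri hd hrow hβ' hrK hρ hρ₁ hρδ hG' hDKN
  have t2 := hasMaj_comp_exp_out blk htri hd hrow hm₀ hcK hρ hρ₁ hρδ hDG hKN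
  rw [commOp_add_left, commOp_add_left, LinearMap.comp_add, LinearMap.comp_add, idef_add, idef_comp (pull π) (pull π) (pull π) G' (commOp N' h') G (commOp N h)]
  refine (hDloc.add (t1.add t2)).mono fun y y' => ?_
  have h1 := loc₂_le_out (S := S) hr₁ hd (show ρ ≤ δ by linarith) y y'
  calc ind S y * ind S y' * (r₁ * Real.exp (-(δ * g.dist y y'))) +
        (ind S y * (β' * rK * cr * Real.exp (-(ρ * g.dist y y'))) + ind S y * (m₀ * cK * cr * Real.exp (-(ρ * g.dist y y'))))
      ≤ ind S y * (r₁ * Real.exp (-(ρ * g.dist y y'))) +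
        (ind S y * (β' * rK * cr * Real.exp (-(ρ * g.dist y y'))) + ind S y * (m₀ * cK * cr * Real.exp (-(ρ * g.dist y y')))) := by linarith
    _ = _ := by ring

end Generic

/-! ## §2 The adjoint rows of `V(C, A) + N` on the vector carrier: species by file 14∕15, the nonlocal part by FILE 56∕57 -/

section SpeciesAdd

variable {X X' ι J : Type} [Fintype X] [Fintype X'] [Fintype ι] [Fintype J] {g : B6.Geometry} (blk : X → g.Site) (π : X' → X) {σ cr : ℝ}
variable (τ : J → X ≃ X) (τ' : J → X' ≃ X') (n n' : ℝ) (C : X → Matrix ι ι ℝ) (C' : X' → Matrix ι ι ℝ) (A : J ⊕ J → X → Matrix ι ι ℝ) (A' : J ⊕ J → X' → Matrix ι ι ℝ)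
  (hX : X → ℝ) (hX' : X' → ℝ) (G : (X × ι → ℝ) →ₗ[ℝ] (X × ι → ℝ)) (G' : (X' × ι → ℝ) →ₗ[ℝ] (X' × ι → ℝ))

omit [Fintype X'] in
/-- ★★ **THE ADJOINT ROW OF `V(C, A) + N`, OUTPUT-LOCALIZED** (FILE 58's `hKcL` currency for the dressed cube's perturbation).  Data on `X × ι`: the cube `G ≤ 1_S(y)1_S(y′)·βe^{−δd}`, its right
entries `G∘∇⁺_μ, G∘∇⁻_μ ≤ 1_S1_S·β₁e^{−δd}`; the partition `h = h_X∘pr₁` with `|∇^±_μh_X| ≤ c₁`, `|h_X∘τ_μ − h_X| ≤ c₀`, within `ω` of a block-constant `hb` with block-Lipschitz constant `ℓ`,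
`ε > 0`; the species rows `Σ_k|A^±_μ(x)_{ik}| ≤ r_A`; the base perturbation `N ≤ R_N·e^{−δ_Nd}`; rates `0 ≤ ρ ≤ δ_N − ε`, `ρ + σ ≤ δ`, `σ ≥ 0`, row sum `(σ, c_r)`.  Then
`G∘[V(C, A) + N, M_h] ≤ 1_S(y)·(|J|·2r_A(c₁β + c₀β₁) + β·(ℓ(eε)⁻¹ + 2ω)R_N·c_r)·e^{−ρd}` — file 14 + FILE 56 `hasMaj_commOp_nonlocal` + FILE 57 `hasMaj_comp_commOp_of_add`.
[cite: Balaban1984PropagatorsI, (1.120)–(1.121) p.37, (1.128) p.38, p.39 (adjoint representation); Balaban1984PropagatorsII, (2.134) p.247 (shape, transposed); Balaban1985BackgroundPropagators, (3.52) p.400, (3.76)–(3.77) pp.405–406 (shapes)] -/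
theorem hasMaj_comp_commOp_speciesOpM_add (htri : Triangle254 g) (hd : ∀ a b : g.Site, 0 ≤ g.dist a b) (hsymm : ∀ y y', g.dist y y' = g.dist y' y) (hrow : RowSum g σ cr) (hσ : 0 ≤ σ)
    {N : (X × ι → ℝ) →ₗ[ℝ] (X × ι → ℝ)} {S : Set g.Site} {hb : g.Site → ℝ} {β β₁ c₁ c₀ rA RN δ δN ε ℓ ω ρ : ℝ} (hβ : 0 ≤ β) (hβ₁ : 0 ≤ β₁) (hc₁ : 0 ≤ c₁) (hc₀ : 0 ≤ c₀)
    (hrA : 0 ≤ rA) (hRN : 0 ≤ RN) (hℓ : 0 ≤ ℓ) (hω : 0 ≤ ω) (hε : 0 < ε) (hρ : 0 ≤ ρ) (hρN : ρ ≤ δN - ε) (hρδ : ρ + σ ≤ δ)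
    (hh1 : ∀ μ x, |fgrad n (τ μ) hX x| ≤ c₁) (hh1b : ∀ μ x, |bgrad n (τ μ) hX x| ≤ c₁) (hh0 : ∀ μ x, |hX (τ μ x) - hX x| ≤ c₀)
    (hLip : ∀ y y', |hb y - hb y'| ≤ ℓ * g.dist y y') (hrh : ∀ x, |hX x - hb (blk x)| ≤ ω) (hA : ∀ j x i, ∑ k, |A j x i k| ≤ rA)
    (hG : HasMaj (BlockNorm.ofBlocks g (liftBlk blk ι)) (BlockNorm.ofBlocks g (liftBlk blk ι)) G (fun y y' => ind S y * ind S y' * (β * Real.exp (-(δ * g.dist y y')))))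
    (hD : ∀ μ, HasMaj (BlockNorm.ofBlocks g (liftBlk blk ι)) (BlockNorm.ofBlocks g (liftBlk blk ι)) (G ∘ₗ fgrad n (liftEquiv (τ μ) ι))
      (fun y y' => ind S y * ind S y' * (β₁ * Real.exp (-(δ * g.dist y y')))))
    (hDb : ∀ μ, HasMaj (BlockNorm.ofBlocks g (liftBlk blk ι)) (BlockNorm.ofBlocks g (liftBlk blk ι)) (G ∘ₗ bgrad n (liftEquiv (τ μ) ι))
      (fun y y' => ind S y * ind S y' * (β₁ * Real.exp (-(δ * g.dist y y')))))
    (hN : HasMaj (BlockNorm.ofBlocks g (liftBlk blk ι)) (BlockNorm.ofBlocks g (liftBlk blk ι)) N (fun y y' => RN * Real.exp (-(δN * g.dist y y')))) :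
    HasMaj (BlockNorm.ofBlocks g (liftBlk blk ι)) (BlockNorm.ofBlocks g (liftBlk blk ι)) (G ∘ₗ commOp (speciesOpM τ n C A + N) (fun p : X × ι => hX p.1))
      (fun y y' => ind S y * ((Fintype.card J * (2 * rA * (c₁ * β + c₀ * β₁)) + β * ((ℓ * (Real.exp 1 * ε)⁻¹ + 2 * ω) * RN) * cr) * Real.exp (-(ρ * g.dist y y')))) := by
  have hKloc := hasMaj_comp_commOp_speciesOpM blk τ n C A hX G hβ hβ₁ hc₁ hc₀ hrA hh1 hh1b hh0 hA hG hD hDb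
  have hKN := hasMaj_commOp_nonlocal (liftBlk blk ι) (h := fun p : X × ι => hX p.1) hRN hℓ hω hε hd hsymm hLip (fun p => hrh p.1) hN
  have hθ₁ : 0 ≤ Fintype.card J * (2 * rA * (c₁ * β + c₀ * β₁)) := by positivity
  have hcK : 0 ≤ (ℓ * (Real.exp 1 * ε)⁻¹ + 2 * ω) * RN := by positivity
  exact hasMaj_comp_commOp_of_add (liftBlk blk ι) htri hd hrow hσ hθ₁ hcK hβ hρ hρN hρδ hKloc hKN hG

/-- ★★ **THE η-DEFECT OF THE ADJOINT ROW OF `V(C, A) + N`, OUTPUT-LOCALIZED** (FILE 58's `hDKL` currency).  Data at two spacings (coarse unprimed on `X × ι`, fine primed on `X′ × ι`, `π : X′ → X`)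
— file 15's: partition letters `c₁, c₀` at both spacings, partition fits `o₁, o₀` along `π`, coarse species rows `r_A`, translated species fits `o_At`, FINE cube `G′ ≤ 1_S1_S·βe^{−δd}` and right
entries `G′∘∇′^± ≤ 1_S1_S·β₁e^{−δd}`, the defects `𝔇(G′, G) ≤ 1_S1_S·m₀e^{−δd}`, `𝔇(G′∘∇′^±, G∘∇^±) ≤ 1_S1_S·m₁e^{−δd}`; — FILE 56's: `h, h′` within `ω` of the block-constant `hb`
(block-Lipschitz `ℓ`), the fit `|h′ − h∘π| ≤ o`, `ε > 0`, the base perturbation at both spacings `N, N′ ≤ c_N·e^{−δ_Nd}` with defect `𝔇(N′, N) ≤ r_N·e^{−δ_Nd}`; rates `0 ≤ ρ ≤ δ_N − ε`,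
`ρ + σ ≤ δ`, `σ ≥ 0`.  Then `𝔇(G′∘[V′ + N′, M_{h′}], G∘[V + N, M_h]) ≤ 1_S(y)·(r_V + β·r_K·c_r + m₀·c_K·c_r)·e^{−ρd}` with file 15's
`r_V = |J|·2(r_A(c₁m₀ + o₁β + c₀m₁ + o₀β₁) + o_At(c₁β + c₀β₁))`, `c_K = (ℓ(eε)⁻¹ + 2ω)c_N`, `r_K = (ℓ(eε)⁻¹ + 2ω)r_N + 2o·c_N`.
[cite: Balaban1984PropagatorsI, (1.120) p.37, (1.128) p.38, p.39; Balaban1984PropagatorsII, (2.133)–(2.134) p.247 (shapes, transposed); Balaban1985BackgroundPropagators, (3.52) p.400, Thm 3.14 pp.426–427 (difference template)] -/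
theorem hasMaj_idef_comp_commOp_speciesOpM_add (htri : Triangle254 g) (hd : ∀ a b : g.Site, 0 ≤ g.dist a b) (hsymm : ∀ y y', g.dist y y' = g.dist y' y) (hrow : RowSum g σ cr)
    (hσ : 0 ≤ σ) {N : (X × ι → ℝ) →ₗ[ℝ] (X × ι → ℝ)} {N' : (X' × ι → ℝ) →ₗ[ℝ] (X' × ι → ℝ)} {S : Set g.Site} {hb : g.Site → ℝ}
    {β β₁ c₁ c₀ o₁ o₀ m₀ m₁ rA oAt cN rN o δ δN ε ℓ ω ρ : ℝ} (hβ : 0 ≤ β) (hβ₁ : 0 ≤ β₁) (hc₁ : 0 ≤ c₁) (hc₀ : 0 ≤ c₀) (ho₁ : 0 ≤ o₁) (ho₀ : 0 ≤ o₀) (hm₀ : 0 ≤ m₀)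
    (hm₁ : 0 ≤ m₁) (hrA : 0 ≤ rA) (hoAt : 0 ≤ oAt) (hcN : 0 ≤ cN) (hrN : 0 ≤ rN) (ho : 0 ≤ o) (hℓ : 0 ≤ ℓ) (hω : 0 ≤ ω) (hε : 0 < ε) (hρ : 0 ≤ ρ) (hρN : ρ ≤ δN - ε)
    (hρδ : ρ + σ ≤ δ)
    -- partition letters, coarse and fine; fits along π; block-constant comparison
    (hh1 : ∀ μ x, |fgrad n (τ μ) hX x| ≤ c₁) (hh1b : ∀ μ x, |bgrad n (τ μ) hX x| ≤ c₁) (hh0 : ∀ μ x, |hX (τ μ x) - hX x| ≤ c₀)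
    (hh1' : ∀ μ x', |fgrad n' (τ' μ) hX' x'| ≤ c₁) (hh1b' : ∀ μ x', |bgrad n' (τ' μ) hX' x'| ≤ c₁) (hh0' : ∀ μ x', |hX' (τ' μ x') - hX' x'| ≤ c₀)
    (hf1 : ∀ μ x', |fgrad n' (τ' μ) hX' x' - fgrad n (τ μ) hX (π x')| ≤ o₁) (hf1b : ∀ μ x', |bgrad n' (τ' μ) hX' x' - bgrad n (τ μ) hX (π x')| ≤ o₁)
    (hf0 : ∀ μ x', |(hX' (τ' μ x') - hX' x') - (hX (τ μ (π x')) - hX (π x'))| ≤ o₀)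
    (hf0b : ∀ μ x', |(hX' x' - hX' ((τ' μ).symm x')) - (hX (π x') - hX ((τ μ).symm (π x')))| ≤ o₀)
    (hfit : ∀ x', |hX' x' - hX (π x')| ≤ o) (hLip : ∀ y y', |hb y - hb y'| ≤ ℓ * g.dist y y') (hrh : ∀ x, |hX x - hb (blk x)| ≤ ω) (hrh' : ∀ x', |hX' x' - hb (blk (π x'))| ≤ ω)
    -- species rows and translated fits
    (hA : ∀ j x i, ∑ k, |A j x i k| ≤ rA)
    (hfAb : ∀ μ x' i, ∑ k, |A' (Sum.inl μ) ((τ' μ).symm x') i k - A (Sum.inl μ) ((τ μ).symm (π x')) i k| ≤ oAt)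
    (hfAf : ∀ μ x' i, ∑ k, |A' (Sum.inr μ) (τ' μ x') i k - A (Sum.inr μ) (τ μ (π x')) i k| ≤ oAt)
    -- fine cube, fine right entries, their defects
    (hG' : HasMaj (BlockNorm.ofBlocks g (liftBlk blk ι ∘ liftMap π ι)) (BlockNorm.ofBlocks g (liftBlk blk ι ∘ liftMap π ι)) G'
      (fun y y' => ind S y * ind S y' * (β * Real.exp (-(δ * g.dist y y')))))
    (hD' : ∀ μ, HasMaj (BlockNorm.ofBlocks g (liftBlk blk ι ∘ liftMap π ι)) (BlockNorm.ofBlocks g (liftBlk blk ι ∘ liftMap π ι)) (G' ∘ₗ fgrad n' (liftEquiv (τ' μ) ι))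
      (fun y y' => ind S y * ind S y' * (β₁ * Real.exp (-(δ * g.dist y y')))))
    (hDb' : ∀ μ, HasMaj (BlockNorm.ofBlocks g (liftBlk blk ι ∘ liftMap π ι)) (BlockNorm.ofBlocks g (liftBlk blk ι ∘ liftMap π ι)) (G' ∘ₗ bgrad n' (liftEquiv (τ' μ) ι))
      (fun y y' => ind S y * ind S y' * (β₁ * Real.exp (-(δ * g.dist y y')))))
    (hDG : HasMaj (BlockNorm.ofBlocks g (liftBlk blk ι)) (BlockNorm.ofBlocks g (liftBlk blk ι ∘ liftMap π ι)) (idef (pull (liftMap π ι)) (pull (liftMap π ι)) G' G)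
      (fun y y' => ind S y * ind S y' * (m₀ * Real.exp (-(δ * g.dist y y')))))
    (hDD : ∀ μ, HasMaj (BlockNorm.ofBlocks g (liftBlk blk ι)) (BlockNorm.ofBlocks g (liftBlk blk ι ∘ liftMap π ι))
      (idef (pull (liftMap π ι)) (pull (liftMap π ι)) (G' ∘ₗ fgrad n' (liftEquiv (τ' μ) ι)) (G ∘ₗ fgrad n (liftEquiv (τ μ) ι)))
      (fun y y' => ind S y * ind S y' * (m₁ * Real.exp (-(δ * g.dist y y')))))
    (hDDb : ∀ μ, HasMaj (BlockNorm.ofBlocks g (liftBlk blk ι)) (BlockNorm.ofBlocks g (liftBlk blk ι ∘ liftMap π ι))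
      (idef (pull (liftMap π ι)) (pull (liftMap π ι)) (G' ∘ₗ bgrad n' (liftEquiv (τ' μ) ι)) (G ∘ₗ bgrad n (liftEquiv (τ μ) ι)))
      (fun y y' => ind S y * ind S y' * (m₁ * Real.exp (-(δ * g.dist y y')))))
    -- the base perturbation at both spacings and its defect
    (hN : HasMaj (BlockNorm.ofBlocks g (liftBlk blk ι)) (BlockNorm.ofBlocks g (liftBlk blk ι)) N (fun y y' => cN * Real.exp (-(δN * g.dist y y'))))
    (hN' : HasMaj (BlockNorm.ofBlocks g (liftBlk blk ι ∘ liftMap π ι)) (BlockNorm.ofBlocks g (liftBlk blk ι ∘ liftMap π ι)) N' (fun y y' => cN * Real.exp (-(δN * g.dist y y'))))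
    (hDN : HasMaj (BlockNorm.ofBlocks g (liftBlk blk ι)) (BlockNorm.ofBlocks g (liftBlk blk ι ∘ liftMap π ι)) (idef (pull (liftMap π ι)) (pull (liftMap π ι)) N' N)
      (fun y y' => rN * Real.exp (-(δN * g.dist y y')))) :
    HasMaj (BlockNorm.ofBlocks g (liftBlk blk ι)) (BlockNorm.ofBlocks g (liftBlk blk ι ∘ liftMap π ι))
      (idef (pull (liftMap π ι)) (pull (liftMap π ι)) (G' ∘ₗ commOp (speciesOpM τ' n' C' A' + N') (fun p' : X' × ι => hX' p'.1))
        (G ∘ₗ commOp (speciesOpM τ n C A + N) (fun p : X × ι => hX p.1)))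
      (fun y y' => ind S y * ((Fintype.card J * (2 * (rA * (c₁ * m₀ + o₁ * β + c₀ * m₁ + o₀ * β₁) + oAt * (c₁ * β + c₀ * β₁))) +
          β * (((ℓ * (Real.exp 1 * ε)⁻¹ + 2 * ω) * rN + 2 * o * cN)) * cr + m₀ * ((ℓ * (Real.exp 1 * ε)⁻¹ + 2 * ω) * cN) * cr) * Real.exp (-(ρ * g.dist y y')))) := by
  have hDloc := hasMaj_idef_comp_commOp_speciesOpM blk π τ τ' n n' C C' A A' hX hX' G G' hβ hβ₁ hc₁ hc₀ ho₁ ho₀ hm₀ hm₁ hrA hoAt hh1 hh1b hh0 hh1' hh1b' hh0' hf1 hf1b hf0 hf0b hA hfAb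
    hfAf hG' hD' hDb' hDG hDD hDDb
  have hKN := hasMaj_commOp_nonlocal (liftBlk blk ι) (h := fun p : X × ι => hX p.1) hcN hℓ hω hε hd hsymm hLip (fun p => hrh p.1) hN
  have hDKN := hasMaj_idef_commOp_nonlocal (liftBlk blk ι) (liftMap π ι) (h := fun p : X × ι => hX p.1) (h' := fun p' : X' × ι => hX' p'.1) hcN hrN hℓ hω ho hε hd hsymm hLip
    (fun p => hrh p.1) (fun p' => hrh' p'.1) (fun p' => hfit p'.1) hN hN' hDN
  have hr₁ : 0 ≤ Fintype.card J * (2 * (rA * (c₁ * m₀ + o₁ * β + c₀ * m₁ + o₀ * β₁) + oAt * (c₁ * β + c₀ * β₁))) := by positivity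
  have hcK : 0 ≤ (ℓ * (Real.exp 1 * ε)⁻¹ + 2 * ω) * cN := by positivity
  have hrK : 0 ≤ (ℓ * (Real.exp 1 * ε)⁻¹ + 2 * ω) * rN + 2 * o * cN := by positivity
  exact hasMaj_idef_comp_commOp_of_add (liftBlk blk ι) (liftMap π ι) htri hd hrow hσ hr₁ hβ hm₀ hcK hrK hρ hρN hρδ hDloc hG' hDG hKN hDKN

end SpeciesAdd

/-! ## §3 The same rows in the dressed-perturbation presentation `𝒱 = V̂∘jet`, `V̂ = unstackM C A + N∘pr₀` (file 23's pair around the flat cube) -/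

section DressedPert

variable {X X' ι J : Type} [Fintype X] [Fintype X'] [Fintype ι] [Fintype J] {g : B6.Geometry} (blk : X → g.Site) (π : X' → X) {σ cr : ℝ}
variable (τ : J → X ≃ X) (τ' : J → X' ≃ X') (n n' : ℝ) (C : X → Matrix ι ι ℝ) (C' : X' → Matrix ι ι ℝ) (A : J ⊕ J → X → Matrix ι ι ℝ) (A' : J ⊕ J → X' → Matrix ι ι ℝ)
  (hX : X → ℝ) (hX' : X' → ℝ) (G : (X × ι → ℝ) →ₗ[ℝ] (X × ι → ℝ)) (G' : (X' × ι → ℝ) →ₗ[ℝ] (X' × ι → ℝ))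

omit [Fintype X] [Fintype X'] in
/-- ★ **THE DRESSED PERTURBATION OF THE KNIT, READ ON THE BASE**: `(unstackM C A + N∘pr₀)∘jet = V(C, A) + N` — the local species reads the jet (file 23 `speciesOpM_eq_unstackM_comp_jet`), the base
operator `N` reads its `none` component (`pr₀∘jet = 1`). [cite: Balaban1985BackgroundPropagators, (3.52) p.400, (3.62)–(3.63) p.402, (3.76) p.405 (shapes)] -/
theorem unstackM_add_base_comp_jet (N : (X × ι → ℝ) →ₗ[ℝ] (X × ι → ℝ)) :
    (unstackM C A + N ∘ₗ projO none) ∘ₗ stack LinearMap.id (fun j : J ⊕ J => Sum.elim (fun μ => fgrad n (liftEquiv (τ μ) ι)) (fun μ => bgrad n (liftEquiv (τ μ) ι)) j) =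
      speciesOpM τ n C A + N := by
  rw [LinearMap.add_comp, ← speciesOpM_eq_unstackM_comp_jet, LinearMap.comp_assoc, projO_none_comp_stack, LinearMap.comp_id]

omit [Fintype X'] in
/-- ★ **`X∘[𝒱, M_h]`, THE LETTER** — §2 `hasMaj_comp_commOp_speciesOpM_add` for the dressed perturbation `𝒱 = (unstackM C A + N∘pr₀)∘jet` of file 23's pair (take `G := X_□ = pr₀∘bgPropV (stack G₀ D) V̂`
with files 23∕25's two-sided entry 0 and right entries): `G∘[𝒱, M_h] ≤ 1_S(y)·(|J|·2r_A(c₁β + c₀β₁) + β·(ℓ(eε)⁻¹ + 2ω)R_N·c_r)·e^{−ρd}` — FILE 58's `hKcL`.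
[cite: Balaban1984PropagatorsI, p.39 (adjoint representation); Balaban1984PropagatorsII, (2.134) p.247 (shape); Balaban1985BackgroundPropagators, (3.62)–(3.65) pp.402–403, (3.76)–(3.77) pp.405–406] -/
theorem hasMaj_comp_commOp_dressedPert (htri : Triangle254 g) (hd : ∀ a b : g.Site, 0 ≤ g.dist a b) (hsymm : ∀ y y', g.dist y y' = g.dist y' y) (hrow : RowSum g σ cr) (hσ : 0 ≤ σ)
    {N : (X × ι → ℝ) →ₗ[ℝ] (X × ι → ℝ)} {S : Set g.Site} {hb : g.Site → ℝ} {β β₁ c₁ c₀ rA RN δ δN ε ℓ ω ρ : ℝ} (hβ : 0 ≤ β) (hβ₁ : 0 ≤ β₁) (hc₁ : 0 ≤ c₁) (hc₀ : 0 ≤ c₀)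
    (hrA : 0 ≤ rA) (hRN : 0 ≤ RN) (hℓ : 0 ≤ ℓ) (hω : 0 ≤ ω) (hε : 0 < ε) (hρ : 0 ≤ ρ) (hρN : ρ ≤ δN - ε) (hρδ : ρ + σ ≤ δ)
    (hh1 : ∀ μ x, |fgrad n (τ μ) hX x| ≤ c₁) (hh1b : ∀ μ x, |bgrad n (τ μ) hX x| ≤ c₁) (hh0 : ∀ μ x, |hX (τ μ x) - hX x| ≤ c₀)
    (hLip : ∀ y y', |hb y - hb y'| ≤ ℓ * g.dist y y') (hrh : ∀ x, |hX x - hb (blk x)| ≤ ω) (hA : ∀ j x i, ∑ k, |A j x i k| ≤ rA)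
    (hG : HasMaj (BlockNorm.ofBlocks g (liftBlk blk ι)) (BlockNorm.ofBlocks g (liftBlk blk ι)) G (fun y y' => ind S y * ind S y' * (β * Real.exp (-(δ * g.dist y y')))))
    (hD : ∀ μ, HasMaj (BlockNorm.ofBlocks g (liftBlk blk ι)) (BlockNorm.ofBlocks g (liftBlk blk ι)) (G ∘ₗ fgrad n (liftEquiv (τ μ) ι))
      (fun y y' => ind S y * ind S y' * (β₁ * Real.exp (-(δ * g.dist y y')))))
    (hDb : ∀ μ, HasMaj (BlockNorm.ofBlocks g (liftBlk blk ι)) (BlockNorm.ofBlocks g (liftBlk blk ι)) (G ∘ₗ bgrad n (liftEquiv (τ μ) ι))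
      (fun y y' => ind S y * ind S y' * (β₁ * Real.exp (-(δ * g.dist y y')))))
    (hN : HasMaj (BlockNorm.ofBlocks g (liftBlk blk ι)) (BlockNorm.ofBlocks g (liftBlk blk ι)) N (fun y y' => RN * Real.exp (-(δN * g.dist y y')))) :
    HasMaj (BlockNorm.ofBlocks g (liftBlk blk ι)) (BlockNorm.ofBlocks g (liftBlk blk ι))
      (G ∘ₗ commOp ((unstackM C A + N ∘ₗ projO none) ∘ₗ
        stack LinearMap.id (fun j : J ⊕ J => Sum.elim (fun μ => fgrad n (liftEquiv (τ μ) ι)) (fun μ => bgrad n (liftEquiv (τ μ) ι)) j)) (fun p : X × ι => hX p.1))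
      (fun y y' => ind S y * ((Fintype.card J * (2 * rA * (c₁ * β + c₀ * β₁)) + β * ((ℓ * (Real.exp 1 * ε)⁻¹ + 2 * ω) * RN) * cr) * Real.exp (-(ρ * g.dist y y')))) := by
  rw [unstackM_add_base_comp_jet]
  exact hasMaj_comp_commOp_speciesOpM_add blk τ n C A hX G htri hd hsymm hrow hσ hβ hβ₁ hc₁ hc₀ hrA hRN hℓ hω hε hρ hρN hρδ hh1 hh1b hh0 hLip hrh hA hG hD hDb hN

/-- ★ **`𝔇(X′∘[𝒱′, M_{h′}], X∘[𝒱, M_h])`, THE η-DEFECT** — §2 `hasMaj_idef_comp_commOp_speciesOpM_add` for the dressed perturbations `𝒱 = (unstackM C A + N∘pr₀)∘jet`, `𝒱′ = (unstackM C′ A′ + N′∘pr₀)∘jet′`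
at two spacings — FILE 58's `hDKL`. [cite: Balaban1984PropagatorsI, p.39 (adjoint representation); Balaban1984PropagatorsII, (2.133)–(2.134) p.247 (shapes); Balaban1985BackgroundPropagators, (3.62)–(3.65) pp.402–403, Thm 3.14 pp.426–427] -/
theorem hasMaj_idef_comp_commOp_dressedPert (htri : Triangle254 g) (hd : ∀ a b : g.Site, 0 ≤ g.dist a b) (hsymm : ∀ y y', g.dist y y' = g.dist y' y) (hrow : RowSum g σ cr) (hσ : 0 ≤ σ)
    {N : (X × ι → ℝ) →ₗ[ℝ] (X × ι → ℝ)} {N' : (X' × ι → ℝ) →ₗ[ℝ] (X' × ι → ℝ)} {S : Set g.Site} {hb : g.Site → ℝ}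
    {β β₁ c₁ c₀ o₁ o₀ m₀ m₁ rA oAt cN rN o δ δN ε ℓ ω ρ : ℝ} (hβ : 0 ≤ β) (hβ₁ : 0 ≤ β₁) (hc₁ : 0 ≤ c₁) (hc₀ : 0 ≤ c₀) (ho₁ : 0 ≤ o₁) (ho₀ : 0 ≤ o₀) (hm₀ : 0 ≤ m₀)
    (hm₁ : 0 ≤ m₁) (hrA : 0 ≤ rA) (hoAt : 0 ≤ oAt) (hcN : 0 ≤ cN) (hrN : 0 ≤ rN) (ho : 0 ≤ o) (hℓ : 0 ≤ ℓ) (hω : 0 ≤ ω) (hε : 0 < ε) (hρ : 0 ≤ ρ) (hρN : ρ ≤ δN - ε)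
    (hρδ : ρ + σ ≤ δ)
    (hh1 : ∀ μ x, |fgrad n (τ μ) hX x| ≤ c₁) (hh1b : ∀ μ x, |bgrad n (τ μ) hX x| ≤ c₁) (hh0 : ∀ μ x, |hX (τ μ x) - hX x| ≤ c₀)
    (hh1' : ∀ μ x', |fgrad n' (τ' μ) hX' x'| ≤ c₁) (hh1b' : ∀ μ x', |bgrad n' (τ' μ) hX' x'| ≤ c₁) (hh0' : ∀ μ x', |hX' (τ' μ x') - hX' x'| ≤ c₀)
    (hf1 : ∀ μ x', |fgrad n' (τ' μ) hX' x' - fgrad n (τ μ) hX (π x')| ≤ o₁) (hf1b : ∀ μ x', |bgrad n' (τ' μ) hX' x' - bgrad n (τ μ) hX (π x')| ≤ o₁)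
    (hf0 : ∀ μ x', |(hX' (τ' μ x') - hX' x') - (hX (τ μ (π x')) - hX (π x'))| ≤ o₀)
    (hf0b : ∀ μ x', |(hX' x' - hX' ((τ' μ).symm x')) - (hX (π x') - hX ((τ μ).symm (π x')))| ≤ o₀)
    (hfit : ∀ x', |hX' x' - hX (π x')| ≤ o) (hLip : ∀ y y', |hb y - hb y'| ≤ ℓ * g.dist y y') (hrh : ∀ x, |hX x - hb (blk x)| ≤ ω) (hrh' : ∀ x', |hX' x' - hb (blk (π x'))| ≤ ω)
    (hA : ∀ j x i, ∑ k, |A j x i k| ≤ rA)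
    (hfAb : ∀ μ x' i, ∑ k, |A' (Sum.inl μ) ((τ' μ).symm x') i k - A (Sum.inl μ) ((τ μ).symm (π x')) i k| ≤ oAt)
    (hfAf : ∀ μ x' i, ∑ k, |A' (Sum.inr μ) (τ' μ x') i k - A (Sum.inr μ) (τ μ (π x')) i k| ≤ oAt)
    (hG' : HasMaj (BlockNorm.ofBlocks g (liftBlk blk ι ∘ liftMap π ι)) (BlockNorm.ofBlocks g (liftBlk blk ι ∘ liftMap π ι)) G'
      (fun y y' => ind S y * ind S y' * (β * Real.exp (-(δ * g.dist y y')))))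
    (hD' : ∀ μ, HasMaj (BlockNorm.ofBlocks g (liftBlk blk ι ∘ liftMap π ι)) (BlockNorm.ofBlocks g (liftBlk blk ι ∘ liftMap π ι)) (G' ∘ₗ fgrad n' (liftEquiv (τ' μ) ι))
      (fun y y' => ind S y * ind S y' * (β₁ * Real.exp (-(δ * g.dist y y')))))
    (hDb' : ∀ μ, HasMaj (BlockNorm.ofBlocks g (liftBlk blk ι ∘ liftMap π ι)) (BlockNorm.ofBlocks g (liftBlk blk ι ∘ liftMap π ι)) (G' ∘ₗ bgrad n' (liftEquiv (τ' μ) ι))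
      (fun y y' => ind S y * ind S y' * (β₁ * Real.exp (-(δ * g.dist y y')))))
    (hDG : HasMaj (BlockNorm.ofBlocks g (liftBlk blk ι)) (BlockNorm.ofBlocks g (liftBlk blk ι ∘ liftMap π ι)) (idef (pull (liftMap π ι)) (pull (liftMap π ι)) G' G)
      (fun y y' => ind S y * ind S y' * (m₀ * Real.exp (-(δ * g.dist y y')))))
    (hDD : ∀ μ, HasMaj (BlockNorm.ofBlocks g (liftBlk blk ι)) (BlockNorm.ofBlocks g (liftBlk blk ι ∘ liftMap π ι))
      (idef (pull (liftMap π ι)) (pull (liftMap π ι)) (G' ∘ₗ fgrad n' (liftEquiv (τ' μ) ι)) (G ∘ₗ fgrad n (liftEquiv (τ μ) ι)))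
      (fun y y' => ind S y * ind S y' * (m₁ * Real.exp (-(δ * g.dist y y')))))
    (hDDb : ∀ μ, HasMaj (BlockNorm.ofBlocks g (liftBlk blk ι)) (BlockNorm.ofBlocks g (liftBlk blk ι ∘ liftMap π ι))
      (idef (pull (liftMap π ι)) (pull (liftMap π ι)) (G' ∘ₗ bgrad n' (liftEquiv (τ' μ) ι)) (G ∘ₗ bgrad n (liftEquiv (τ μ) ι)))
      (fun y y' => ind S y * ind S y' * (m₁ * Real.exp (-(δ * g.dist y y')))))
    (hN : HasMaj (BlockNorm.ofBlocks g (liftBlk blk ι)) (BlockNorm.ofBlocks g (liftBlk blk ι)) N (fun y y' => cN * Real.exp (-(δN * g.dist y y'))))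
    (hN' : HasMaj (BlockNorm.ofBlocks g (liftBlk blk ι ∘ liftMap π ι)) (BlockNorm.ofBlocks g (liftBlk blk ι ∘ liftMap π ι)) N' (fun y y' => cN * Real.exp (-(δN * g.dist y y'))))
    (hDN : HasMaj (BlockNorm.ofBlocks g (liftBlk blk ι)) (BlockNorm.ofBlocks g (liftBlk blk ι ∘ liftMap π ι)) (idef (pull (liftMap π ι)) (pull (liftMap π ι)) N' N)
      (fun y y' => rN * Real.exp (-(δN * g.dist y y')))) :
    HasMaj (BlockNorm.ofBlocks g (liftBlk blk ι)) (BlockNorm.ofBlocks g (liftBlk blk ι ∘ liftMap π ι))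
      (idef (pull (liftMap π ι)) (pull (liftMap π ι))
        (G' ∘ₗ commOp ((unstackM C' A' + N' ∘ₗ projO none) ∘ₗ
          stack LinearMap.id (fun j : J ⊕ J => Sum.elim (fun μ => fgrad n' (liftEquiv (τ' μ) ι)) (fun μ => bgrad n' (liftEquiv (τ' μ) ι)) j)) (fun p' : X' × ι => hX' p'.1))
        (G ∘ₗ commOp ((unstackM C A + N ∘ₗ projO none) ∘ₗ
          stack LinearMap.id (fun j : J ⊕ J => Sum.elim (fun μ => fgrad n (liftEquiv (τ μ) ι)) (fun μ => bgrad n (liftEquiv (τ μ) ι)) j)) (fun p : X × ι => hX p.1)))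
      (fun y y' => ind S y * ((Fintype.card J * (2 * (rA * (c₁ * m₀ + o₁ * β + c₀ * m₁ + o₀ * β₁) + oAt * (c₁ * β + c₀ * β₁))) +
          β * (((ℓ * (Real.exp 1 * ε)⁻¹ + 2 * ω) * rN + 2 * o * cN)) * cr + m₀ * ((ℓ * (Real.exp 1 * ε)⁻¹ + 2 * ω) * cN) * cr) * Real.exp (-(ρ * g.dist y y')))) := by
  rw [unstackM_add_base_comp_jet, unstackM_add_base_comp_jet]
  exact hasMaj_idef_comp_commOp_speciesOpM_add blk π τ τ' n n' C C' A A' hX hX' G G' htri hd hsymm hrow hσ hβ hβ₁ hc₁ hc₀ ho₁ ho₀ hm₀ hm₁ hrA hoAt hcN hrN ho hℓ hω hε hρ hρN hρδ hh1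
    hh1b hh0 hh1' hh1b' hh0' hf1 hf1b hf0 hf0b hfit hLip hrh hrh' hA hfAb hfAf hG' hD' hDb' hDG hDD hDDb hN hN' hDN

end DressedPert

end Summit.QuantumFields.YangMills.BalabanUVNodes.N15.CurvedSpecies

end
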